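import Summits.CriticalPhenomena.PercolationContinuityZ3.Theorems.Transplant.AutChartTreeSkeleton
import Summits.CriticalPhenomena.PercolationContinuityZ3.Theorems.Transplant.PlanarSkeletonFrmQuasiProxies
import HarnessLib

/-!
# The TREE CHART of an action with finitely many orbits, VI: PROXIES of the carrier `TreeDatum.skeleton` at EVERY base vertex — the customer side of the
# (N3-b) quasi-step node, complete: finite orbits + rank-two character + no exponential growth ⇒ `PlanarSkeletonFrmQuasi` WITH `HasProxies` at every type

builds on p205010 (kernel theorem, internal audit signed; external expert review pending) — nothing in this file uses p205010 and nothing here is a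
percolation statement or a claim about any node (the hC-node over `PlanarSkeletonFrmQuasi` is the planners'/lead's and is NOT declared here).
Lane `prim-bschramm`, seat `prim-bschramm-p5` gen 28 (refuter / sharpness seat; adapter (L4) wrapper over stmt-g33's (c3) «PlanarSkeletonFrmQuasiProxies»).
Helper file (`--supports stmt-CriticalPhenomena-4575 --as helper`); PROOFS ONLY (def-free).
* **`TreeDatum.skeleton_hasProxies`**: `∃ Dp, ∀ t, (D.skeleton hc hker).HasProxies t Dp` (from «AutChartTreeSkeleton» `exists_coarse_proxies`; the frame is
  the action of the chosen group element);
* **`AutChart.exists_frmQuasi_hasProxies`**: every action by automorphisms of a connected locally finite graph WITHOUT exponential growth, with finitely many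
  orbits and a character of rank two killing one stabiliser, yields a `PlanarSkeletonFrmQuasi G` carrying `HasProxies t Dp` at EVERY vertex `t` (in
  particular at every type), whose chart is the coarse tree chart of a tree datum with character `rebase ∘ c` — exactly the data the node's hypothesis list
  reads; on exponential growth the node's conclusion is Hutchcroft's theorem.
[cite: KozmaNitzan2024, §4 p. 16 (Lemma 8), p. 19 (Step III)] [cite: BenjaminiSchramm1996, §2 (almost transitive graphs)] [cite: MilnorSolvableGrowth1968, Lemma 1]
-/

noncomputable section

namespace Summit.CriticalPhenomena.PercolationContinuityZ3.Theorems.Transplant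

open SimpleGraph Literature.Barriers.CriticalPhenomena Literature.Probability.LatticeModels Literature.Probability.Percolation
open scoped Classical

namespace AutChart

namespace TreeDatum

variable {V : Type} {G : SimpleGraph V} {A : Type} [Group A] [MulAction A V] (D : TreeDatum G A) [G.LocallyFinite]

/-- **THE CARRIER OF A TREE DATUM HAS PROXIES AT EVERY VERTEX** (uniform radius): `(D.skeleton hc hker).HasProxies t Dp` for all `t`. [this work] -/
theorem skeleton_hasProxies (hc : G.Connected) {m : ℕ}
    (hker : ∀ r ∈ D.reps, ∀ k : A, D.c k = 1 → k ∈ Subgroup.closure {g : A | D.c g = 1 ∧ g • r ∈ graphBall G r m}) :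
    ∃ Dp : ℕ, ∀ t : V, (D.skeleton hc hker).HasProxies t Dp := by
  obtain ⟨Dp, h⟩ := D.exists_coarse_proxies hc
  refine ⟨Dp, fun t c => ?_⟩
  obtain ⟨c', g, hgt, htr, hval, hball⟩ := h t c
  exact ⟨c', smulIso D.act g, hgt, fun w => by rw [smulIso_apply]; exact htr w, hval, hball⟩

end TreeDatum

/-- **THE CUSTOMER SIDE OF THE QUASI-STEP NODE, COMPLETE**: a connected locally finite graph WITHOUT exponential growth, acted on by automorphisms with finitely
many orbits and a character `c : A → ℤ²` of rank two killing one stabiliser, carries a `PlanarSkeletonFrmQuasi G` (the design owner's carrier p507026: 1-Lipschitz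
chart, translating frames with finitely many types, degree bound, EXACT-footprint quasi-steps, cylinders joined inside a fattening) together with PROXIES
`HasProxies t Dp` at EVERY vertex `t`; its chart is the coarse tree chart of a tree datum `D` with `D.c = rebase ∘ c`.  No step hypothesis, no alignment
hypothesis, no max-area re-basing. [cite: KozmaNitzan2024, §4 p. 16 (Lemma 8), p. 19 (Step III)] [cite: BenjaminiSchramm1996, §2 (almost transitive graphs)]
[cite: MilnorSolvableGrowth1968, Lemma 1] [cite: Hutchcroft2016, Thm. 1.1] -/
theorem exists_frmQuasi_hasProxies {V : Type} {G : SimpleGraph V} {A : Type} [Group A] [MulAction A V] [G.LocallyFinite]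
    (hact : IsActionByAut G A) (hc : G.Connected) (reps₀ : Finset V) (hcover₀ : ∀ w : V, ∃ a : A, ∃ r ∈ reps₀, a • r = w)
    (c : A →* Multiplicative (Site 2)) {t : V} (hstab : ∀ h ∈ MulAction.stabilizer A t, c h = 1)
    (hrank : ∃ a b : A, MaxArea.det2 (Multiplicative.toAdd (c a)) (Multiplicative.toAdd (c b)) ≠ 0) (hG : ¬ HasExponentialGrowth G) :
    ∃ (D : TreeDatum G A) (Φ : PlanarSkeletonFrmQuasi G) (Dp : ℕ) (u w : Site 2),
      D.c = (rebaseHom u w).comp c ∧ Φ.φ = D.coarse ∧ ∀ s : V, Φ.HasProxies s Dp := by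
  obtain ⟨D, m, hker, u, w, hc', hφ⟩ := TreeDatum.exists_skeleton hact hc reps₀ hcover₀ c hstab hrank hG
  obtain ⟨Dp, hDp⟩ := D.skeleton_hasProxies hc hker
  exact ⟨D, D.skeleton hc hker, Dp, u, w, hc', hφ, hDp⟩

end AutChart

end Summit.CriticalPhenomena.PercolationContinuityZ3.Theorems.Transplant

end
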